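import Literature.MathematicalPhysics.QuantumFieldTheory.Balaban1983to89.B4GaussRep36

/-!
# [B4] (1.13) and (3.5) in r01's plain-matrix dictionary: `Δ^{(k)}(Ω,A)` as a Schur complement, and the operator
`Δ^{(k)}(Ω,A) + aL^{−2}P(A)` of (1.13)/(1.15), all its compressions `(·)|_Λ`, and the two-scale form `K̂_Λ` of (3.5)
POSITIVE DEFINITE from one zero-mode hypothesis — so `C^{(k)}_Λ(Ω,A)` and `G_k(Ω,Λ,A)` are honest inverses

T. Bałaban, *Regularity and decay of lattice Green's functions*, Commun. Math. Phys. **89** (1983) 571–597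
[Balaban1983RegularityDecay] (= [B4]; journal page = PDF page + 570).

statement-level skeleton of published theorems with citation tags; proofs where landed; nothing here is a claim about the Yang–Mills mass gap

PDF held: `paper:balaban1983-cmp89-regularity-decay`; pp. 572–574 [PDF 2–4] and 586–588 [PDF 16–18] (the displays
(1.13)–(1.15), (3.5) are transcribed verbatim in `B4GaussRep36`).

WHAT IS REPRODUCED = SKELETON rows **B4.Eq1.13** («`C^{(k)}_Λ(Ω,A) = ((Δ^{(k)}(Ω,A) + aL^{−2}P(A))|_Λ)^{−1}`,
`X|_Λ = ΛXΛ`», p. 573 [PDF 3]), **B4.Eq3.5** («`G_k(Ω,Λ,A) = (−Δ^{η,N}_{A,Ω} + m_k² + a_kP_k(A)(Ω∖B^k(Λ)) +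
a_{k+1}L^{−2}P_{k+1}(A)B^k(Λ))^{−1}`», p. 587 [PDF 17]) and the standing hypothesis of row **B4.Prop2.3[I]**'s §3/§5
routes (owner r01), unit `lit-balaban-p35` gen 4 (Phase-2 proof seat, free-target protocol G.5-34(d); HOME
`run/shared/lean/pub/lit-balaban/`); file 1 of 2 (file 2 `B4Eq35TwoLevelPosDef`: the zero-mode hypothesis PROVED on
the concrete two-level carriers, for every configuration).  Both displays DEFINE an inverse.  In the tree the letters
are r01's plain-matrix dictionary `B4GaussRep36` (`kForm` = K̂ of (1.6), `gk`, `deltaK` (1.14), `pOp`, `cOpLam`/`cLam`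
(1.13), `qNext`, `kLam`/`gLam` (3.5)), whose consumers — `B4Ineq115Sect3Route`, `B4Prop23BlockAvg`,
`B4Prop23Sect5Route`, `B4Sect3BlockAveraging`, `B4GaussRep36.Rep36` — carry the positivity of the two-scale form as
the HYPOTHESIS `hKΛ : (kLam …).PosDef` / `hKU` (the content of (1.8) for (3.5)).

WHAT IS PROVED HERE (0 sorry, standard axioms, no new definitions; plain matrices `H : X×X` — the form of
`−Δ^{η,N}_{A,Ω} + m²` —, `Qk : Y×X` — (1.4) —, `Q : Z×Y` — the next-level averaging —).  The mechanism is ours and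
elementary (the paper takes the existence of these inverses for granted):
* the variational (Schur-complement) identity behind (1.14), `⟨ψ, Δ^{(k)}ψ⟩ = ⟨φ_*, Hφ_*⟩ + a_k|ψ − Q_kφ_*|²` at
  `φ_* = a_kG_kQ_kᵀψ` (`deltaK_form_eq_at_min`; the Gaussian integral of (3.1)–(3.4) evaluated at its saddle), whence
  `Δ^{(k)}(Ω,A) ≥ 0` for `H ≥ 0` (`deltaK_form_nonneg`) and its zero modes are `ψ = Q_kφ` with `⟨φ,Hφ⟩ = 0`
  (`deltaK_form_eq_zero`);
* from ONE hypothesis `hzero` — «a field with `⟨φ,Hφ⟩ = 0` and `Q_{k+1}φ = QQ_kφ = 0` vanishes» (vacuous when `H > 0`,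
  i.e. `m² > 0`: `hzero_of_posDef`) — the operator `Δ^{(k)}(Ω,A) + aL^{−2}P(A)` of (1.13)/(1.15) is POSITIVE DEFINITE
  (**`form113_posDef`**), so is every principal compression (`posDef_submatrix_of_injective`, **`cOpLam_posDef`**,
  EVERY `Λ`), and `C^{(k)}_Λ(Ω,A)` is an honest two-sided inverse, itself positive definite (`cLam_mul_cOpLam`,
  `cOpLam_mul_cLam`, `cLam_posDef'` — without (3.6), cf. `B4Ineq115Sect3Route.cLam_posDef`);
* under the same hypothesis the two-scale form (3.5) is positive definite for every block-compatible pair `(Λ, Λ′)`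
  (**`kLam_posDef`** — no use of `K̂ > 0`) and for `Λ = Λ′ = univ` (**`kLam_univ_posDef`**, the form of
  `G^η_{k+1}(Ω,A)` of (3.9)) — the hypotheses `hKΛ`/`hKU` of the consumers above reduced to `hzero`.

HONEST SCOPE.  (a) Qualitative: positive definiteness and existence of the inverses; no constants uniform in
`η, Ω, A` (those are (1.15)/(1.8), proved under regularity in `B4Ineq53RegularRegion`/`B4Lower18*`).  (b) The zero-mode
hypothesis is discharged for the concrete carriers in file 2; here it is an explicit binder.  (c) Nothing printed is
weakened or asserted beyond (1.13)/(3.5) being definitions of inverses that exist.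
-/

namespace Literature.MathematicalPhysics.QuantumFieldTheory.Balaban1983to89.B4Eq35TwoScalePosDef

open Matrix Finset
open Literature.MathematicalPhysics.QuantumFieldTheory.Balaban1983to89.B4GaussRep36 (kForm gk deltaK pOp cOpLam cLam
  qNext kLam aNext diagInd BlockCompatible)

/-- `0 ≤ |v|²` (private plumbing). [folklore] -/
private theorem dot_self_nonneg {W : Type*} [Fintype W] (v : W → ℝ) : 0 ≤ v ⬝ᵥ v :=
  Finset.sum_nonneg fun _ _ => mul_self_nonneg _

/-! ## §1. The plain-matrix dictionary: (1.14) as a Schur complement, (1.13) and (3.5) positive definite -/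

section Abstract

variable {X Y Z : Type*} [Fintype X] [Fintype Y] [Fintype Z] [DecidableEq X] [DecidableEq Y] [DecidableEq Z]

omit [DecidableEq X] [DecidableEq Y] in
/-- the form of `K̂ = H + a_kQ_kᵀQ_k` (1.6): `⟨φ, K̂φ⟩ = ⟨φ, Hφ⟩ + a_k|Q_kφ|²`. [cite: Balaban1983RegularityDecay, (1.6) p.572] -/
theorem kForm_form (H : Matrix X X ℝ) (ak : ℝ) (Qk : Matrix Y X ℝ) (φ : X → ℝ) :
    φ ⬝ᵥ (kForm H ak Qk *ᵥ φ) = φ ⬝ᵥ (H *ᵥ φ) + ak * ((Qk *ᵥ φ) ⬝ᵥ (Qk *ᵥ φ)) := by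
  rw [kForm, Matrix.add_mulVec, dotProduct_add, Matrix.smul_mulVec, dotProduct_smul, smul_eq_mul,
    ← Matrix.mulVec_mulVec, Matrix.dotProduct_mulVec φ Qkᵀ, Matrix.vecMul_transpose]

/-- the form of (1.14): `⟨ψ, Δ^{(k)}ψ⟩ = a_k|ψ|² − a_k²⟨Q_kᵀψ, G_k Q_kᵀψ⟩`. [cite: Balaban1983RegularityDecay, (1.14) p.573] -/
theorem deltaK_form (H : Matrix X X ℝ) (ak : ℝ) (Qk : Matrix Y X ℝ) (ψ : Y → ℝ) :
    ψ ⬝ᵥ (deltaK H ak Qk *ᵥ ψ) = ak * (ψ ⬝ᵥ ψ) - ak ^ 2 * ((Qkᵀ *ᵥ ψ) ⬝ᵥ (gk H ak Qk *ᵥ (Qkᵀ *ᵥ ψ))) := by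
  rw [deltaK, Matrix.sub_mulVec, dotProduct_sub, Matrix.smul_mulVec, Matrix.one_mulVec, dotProduct_smul,
    Matrix.smul_mulVec, dotProduct_smul, smul_eq_mul, smul_eq_mul, ← Matrix.mulVec_mulVec,
    ← Matrix.mulVec_mulVec, Matrix.dotProduct_mulVec ψ Qk, ← Matrix.mulVec_transpose]

omit [DecidableEq Y] [DecidableEq Z] in
/-- the form of the next-level projection `P = wQᵀQ`: `⟨v, Pv⟩ = w|Qv|²`. [cite: Balaban1983RegularityDecay, (1.13) p.573, (5.1) p.593] -/
theorem pOp_form (w : ℝ) (Q : Matrix Z Y ℝ) (v : Y → ℝ) :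
    v ⬝ᵥ (pOp w Q *ᵥ v) = w * ((Q *ᵥ v) ⬝ᵥ (Q *ᵥ v)) := by
  rw [pOp, Matrix.smul_mulVec, dotProduct_smul, smul_eq_mul, ← Matrix.mulVec_mulVec, Matrix.dotProduct_mulVec v Qᵀ,
    Matrix.vecMul_transpose]

/-- **(1.14) AS A SCHUR COMPLEMENT — the variational identity at the minimiser**: with `K̂ = H + a_kQ_kᵀQ_k`
positive definite, `G_k = K̂⁻¹` and `φ_* = a_kG_kQ_kᵀψ`,
`⟨ψ, Δ^{(k)}ψ⟩ = ⟨φ_*, Hφ_*⟩ + a_k|ψ − Q_kφ_*|²` (the value at the minimum of `φ ↦ ⟨φ,Hφ⟩ + a_k|ψ − Q_kφ|²`, the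
Gaussian integral behind (3.1)–(3.4)). [cite: Balaban1983RegularityDecay, (1.14) p.573, (3.1)–(3.4) pp.586–587] -/
theorem deltaK_form_eq_at_min {H : Matrix X X ℝ} {ak : ℝ} {Qk : Matrix Y X ℝ} (hK : (kForm H ak Qk).PosDef)
    (ψ : Y → ℝ) :
    ψ ⬝ᵥ (deltaK H ak Qk *ᵥ ψ) =
      (ak • (gk H ak Qk *ᵥ (Qkᵀ *ᵥ ψ))) ⬝ᵥ (H *ᵥ (ak • (gk H ak Qk *ᵥ (Qkᵀ *ᵥ ψ))))
        + ak * ((ψ - Qk *ᵥ (ak • (gk H ak Qk *ᵥ (Qkᵀ *ᵥ ψ)))) ⬝ᵥ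
            (ψ - Qk *ᵥ (ak • (gk H ak Qk *ᵥ (Qkᵀ *ᵥ ψ))))) := by
  set u : X → ℝ := Qkᵀ *ᵥ ψ with hu
  set g : X → ℝ := gk H ak Qk *ᵥ u with hg
  have hdet : IsUnit (kForm H ak Qk).det := (Matrix.isUnit_iff_isUnit_det _).1 hK.isUnit
  -- `K̂ g = u`
  have hKg : kForm H ak Qk *ᵥ g = u := by
    rw [hg, gk, Matrix.mulVec_mulVec, Matrix.mul_nonsing_inv _ hdet, Matrix.one_mulVec]
  -- scalar bookkeeping
  have e1 : g ⬝ᵥ (kForm H ak Qk *ᵥ g) = g ⬝ᵥ (H *ᵥ g) + ak * ((Qk *ᵥ g) ⬝ᵥ (Qk *ᵥ g)) := kForm_form H ak Qk g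
  rw [hKg] at e1
  have e2 : (Qk *ᵥ g) ⬝ᵥ ψ = g ⬝ᵥ u := by
    rw [hu, Matrix.dotProduct_mulVec g Qkᵀ, Matrix.vecMul_transpose]
  have e3 : ψ ⬝ᵥ (deltaK H ak Qk *ᵥ ψ) = ak * (ψ ⬝ᵥ ψ) - ak ^ 2 * (u ⬝ᵥ g) := deltaK_form H ak Qk ψ
  have e4 : u ⬝ᵥ g = g ⬝ᵥ u := dotProduct_comm _ _
  -- expand the right-hand side in the atoms `g⬝Hg`, `|Qk g|²`, `(Qk g)⬝ψ`, `|ψ|²`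
  have rhs1 : (ak • g) ⬝ᵥ (H *ᵥ (ak • g)) = ak ^ 2 * (g ⬝ᵥ (H *ᵥ g)) := by
    rw [Matrix.mulVec_smul, smul_dotProduct, dotProduct_smul, smul_eq_mul, smul_eq_mul]; ring
  have rhs2 : (ψ - Qk *ᵥ (ak • g)) ⬝ᵥ (ψ - Qk *ᵥ (ak • g))
      = ψ ⬝ᵥ ψ - 2 * ak * ((Qk *ᵥ g) ⬝ᵥ ψ) + ak ^ 2 * ((Qk *ᵥ g) ⬝ᵥ (Qk *ᵥ g)) := by
    rw [Matrix.mulVec_smul, sub_dotProduct, dotProduct_sub, dotProduct_sub, smul_dotProduct, dotProduct_smul,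
      dotProduct_smul, smul_dotProduct, smul_eq_mul, smul_eq_mul, smul_eq_mul, smul_eq_mul,
      dotProduct_comm ψ (Qk *ᵥ g)]
    ring
  rw [rhs1, rhs2, e3, e4]
  have e5 : g ⬝ᵥ (H *ᵥ g) = g ⬝ᵥ u - ak * ((Qk *ᵥ g) ⬝ᵥ (Qk *ᵥ g)) := by linarith
  rw [e5, e2]
  ring

/-- **`Δ^{(k)}(Ω,A) ≥ 0`** whenever `H ≥ 0` (`m² ≥ 0`), `a_k ≥ 0` and `K̂` is positive definite ((1.6) well posed).
[cite: Balaban1983RegularityDecay, (1.14) p.573, (1.15) p.574] -/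
theorem deltaK_form_nonneg {H : Matrix X X ℝ} {ak : ℝ} {Qk : Matrix Y X ℝ} (hK : (kForm H ak Qk).PosDef)
    (hH0 : ∀ φ : X → ℝ, 0 ≤ φ ⬝ᵥ (H *ᵥ φ)) (hak : 0 ≤ ak) (ψ : Y → ℝ) : 0 ≤ ψ ⬝ᵥ (deltaK H ak Qk *ᵥ ψ) := by
  rw [deltaK_form_eq_at_min hK ψ]
  exact add_nonneg (hH0 _) (mul_nonneg hak (dot_self_nonneg _))

/-- **THE ZERO MODES OF `Δ^{(k)}(Ω,A)`**: if `⟨ψ, Δ^{(k)}ψ⟩ = 0` (`H ≥ 0`, `a_k > 0`, `K̂ > 0`) then `ψ = Q_kφ` for a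
field `φ` with `⟨φ, Hφ⟩ = 0`. [cite: Balaban1983RegularityDecay, (1.14) p.573] -/
theorem deltaK_form_eq_zero {H : Matrix X X ℝ} {ak : ℝ} {Qk : Matrix Y X ℝ} (hK : (kForm H ak Qk).PosDef)
    (hH0 : ∀ φ : X → ℝ, 0 ≤ φ ⬝ᵥ (H *ᵥ φ)) (hak : 0 < ak) {ψ : Y → ℝ} (h0 : ψ ⬝ᵥ (deltaK H ak Qk *ᵥ ψ) = 0) :
    ∃ φ : X → ℝ, φ ⬝ᵥ (H *ᵥ φ) = 0 ∧ Qk *ᵥ φ = ψ := by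
  set φ : X → ℝ := ak • (gk H ak Qk *ᵥ (Qkᵀ *ᵥ ψ)) with hφ
  rw [deltaK_form_eq_at_min hK ψ, ← hφ] at h0
  have h1 : 0 ≤ φ ⬝ᵥ (H *ᵥ φ) := hH0 φ
  have h2 : 0 ≤ ak * ((ψ - Qk *ᵥ φ) ⬝ᵥ (ψ - Qk *ᵥ φ)) := mul_nonneg hak.le (dot_self_nonneg _)
  refine ⟨φ, by linarith, ?_⟩
  have h3 : (ψ - Qk *ᵥ φ) ⬝ᵥ (ψ - Qk *ᵥ φ) = 0 := by
    have : ak * ((ψ - Qk *ᵥ φ) ⬝ᵥ (ψ - Qk *ᵥ φ)) = 0 := by linarith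
    rcases mul_eq_zero.1 this with h | h
    · exact absurd h hak.ne'
    · exact h
  exact (sub_eq_zero.1 (dotProduct_self_eq_zero.1 h3)).symm

omit [DecidableEq Y] in
/-- `G_k = K̂⁻¹` is symmetric when `K̂` is (private plumbing). [folklore] -/
private theorem gk_transpose {H : Matrix X X ℝ} {ak : ℝ} {Qk : Matrix Y X ℝ} (hK : (kForm H ak Qk).PosDef) :
    (gk H ak Qk)ᵀ = gk H ak Qk := by
  have hKt : (kForm H ak Qk)ᵀ = kForm H ak Qk := by
    have h := hK.isHermitian
    rwa [Matrix.IsHermitian, Matrix.conjTranspose_eq_transpose_of_trivial] at h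
  rw [gk, Matrix.transpose_nonsing_inv, hKt]

omit [DecidableEq Z] in
/-- **THE OPERATOR `Δ^{(k)}(Ω,A) + aL^{−2}P(A)` OF (1.13)/(1.15) IS POSITIVE DEFINITE** (`ℓ = L^{−2}`, `P = wQᵀQ`)
under: `⟨φ,Hφ⟩ ≥ 0`, `K̂ = H + a_kQ_kᵀQ_k > 0` (so `H`, `K̂`, `G_k` are symmetric), `a_k > 0`, `aℓ > 0`, `w > 0`, and the zero-mode
hypothesis «`⟨φ,Hφ⟩ = 0` and `QQ_kφ = 0` imply `φ = 0`».  Mechanism: a zero mode `ψ` has `⟨ψ,Δ^{(k)}ψ⟩ = 0` and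
`Qψ = 0`; the first gives `ψ = Q_kφ` with `⟨φ,Hφ⟩ = 0`, so `QQ_kφ = 0` and `φ = 0`.
[cite: Balaban1983RegularityDecay, (1.13) p.573, (1.15) p.574] -/
theorem form113_posDef {H : Matrix X X ℝ} {ak : ℝ} {Qk : Matrix Y X ℝ} {a ℓ w : ℝ} {Q : Matrix Z Y ℝ}
    (hH0 : ∀ φ : X → ℝ, 0 ≤ φ ⬝ᵥ (H *ᵥ φ)) (hK : (kForm H ak Qk).PosDef) (hak : 0 < ak)
    (haℓ : 0 < a * ℓ) (hw : 0 < w)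
    (hzero : ∀ φ : X → ℝ, φ ⬝ᵥ (H *ᵥ φ) = 0 → qNext Q Qk *ᵥ φ = 0 → φ = 0) :
    (deltaK H ak Qk + (a * ℓ) • pOp w Q).PosDef := by
  refine Matrix.PosDef.of_dotProduct_mulVec_pos ?_ fun v hv => ?_
  · rw [Matrix.IsHermitian, Matrix.conjTranspose_eq_transpose_of_trivial, Matrix.transpose_add,
      Matrix.transpose_smul, deltaK, pOp, Matrix.transpose_sub, Matrix.transpose_smul, Matrix.transpose_smul,
      Matrix.transpose_one, Matrix.transpose_mul, Matrix.transpose_mul, Matrix.transpose_transpose, gk_transpose hK,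
      Matrix.transpose_smul, Matrix.transpose_mul, Matrix.transpose_transpose, ← Matrix.mul_assoc]
  rw [star_trivial]
  have h1 := deltaK_form_nonneg hK hH0 hak.le v
  have h2 : 0 ≤ (Q *ᵥ v) ⬝ᵥ (Q *ᵥ v) := dot_self_nonneg _
  have hform : v ⬝ᵥ ((deltaK H ak Qk + (a * ℓ) • pOp w Q) *ᵥ v)
      = v ⬝ᵥ (deltaK H ak Qk *ᵥ v) + a * ℓ * (w * ((Q *ᵥ v) ⬝ᵥ (Q *ᵥ v))) := by
    rw [Matrix.add_mulVec, dotProduct_add, Matrix.smul_mulVec, dotProduct_smul, smul_eq_mul, pOp_form]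
  rw [hform]
  rcases (add_nonneg h1 (mul_nonneg haℓ.le (mul_nonneg hw.le h2))).lt_or_eq with h | h
  · exact h
  · exfalso
    have hΔ : v ⬝ᵥ (deltaK H ak Qk *ᵥ v) = 0 := by nlinarith [mul_nonneg haℓ.le (mul_nonneg hw.le h2)]
    have hQ : (Q *ᵥ v) ⬝ᵥ (Q *ᵥ v) = 0 := by
      have : a * ℓ * (w * ((Q *ᵥ v) ⬝ᵥ (Q *ᵥ v))) = 0 := by linarith
      rcases mul_eq_zero.1 this with h' | h'
      · exact absurd h' haℓ.ne'
      · rcases mul_eq_zero.1 h' with h'' | h''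
        · exact absurd h'' hw.ne'
        · exact h''
    obtain ⟨φ, hφH, hφ⟩ := deltaK_form_eq_zero hK hH0 hak hΔ
    have hφ0 : φ = 0 := hzero φ hφH (by
      rw [qNext, ← Matrix.mulVec_mulVec, hφ]; exact dotProduct_self_eq_zero.1 hQ)
    apply hv
    rw [← hφ, hφ0, Matrix.mulVec_zero]

/-- A PRINCIPAL COMPRESSION OF A POSITIVE DEFINITE MATRIX IS POSITIVE DEFINITE (`X|_Λ = ΛXΛ`, p. 573): for an
injective relabelling `f`, `M.submatrix f f > 0`. [cite: Balaban1983RegularityDecay, (1.13) p.573 «X|_Λ = ΛXΛ»] -/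
theorem posDef_submatrix_of_injective {Λ : Type*} [Fintype Λ] [DecidableEq Λ] {M : Matrix Y Y ℝ} (hM : M.PosDef)
    {f : Λ → Y} (hf : Function.Injective f) : (M.submatrix f f).PosDef := by
  set P : Matrix Y Λ ℝ := Matrix.of fun y j => if f j = y then (1 : ℝ) else 0 with hP
  have hsub : M.submatrix f f = Pᵀ * M * P := by
    ext i j
    simp only [Matrix.submatrix_apply, Matrix.mul_apply, Matrix.transpose_apply, hP, Matrix.of_apply, ite_mul,
      one_mul, zero_mul, mul_ite, mul_one, mul_zero, Finset.sum_ite_eq, Finset.mem_univ, if_true]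
  have hPu : ∀ (u : Λ → ℝ) (i : Λ), (P *ᵥ u) (f i) = u i := by
    intro u i
    simp only [Matrix.mulVec, dotProduct, hP, Matrix.of_apply, hf.eq_iff, ite_mul, one_mul, zero_mul,
      Finset.sum_ite_eq', Finset.mem_univ, if_true]
  refine Matrix.PosDef.of_dotProduct_mulVec_pos (hM.isHermitian.submatrix f) fun u hu => ?_
  rw [star_trivial]
  have hne : P *ᵥ u ≠ 0 := by
    intro h0
    apply hu
    funext i
    have := congrFun h0 (f i)
    rwa [hPu] at this
  have h := hM.dotProduct_mulVec_pos hne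
  rw [star_trivial] at h
  rwa [hsub, Matrix.mul_assoc, ← Matrix.mulVec_mulVec, ← Matrix.mulVec_mulVec, Matrix.dotProduct_mulVec u Pᵀ,
    Matrix.vecMul_transpose]

omit [DecidableEq Z] in
/-- **THE OPERATOR `(Δ^{(k)}(Ω,A) + aL^{−2}P(A))|_Λ` OF (1.13) IS POSITIVE DEFINITE FOR EVERY `Λ`** under the
hypotheses of `form113_posDef`. [cite: Balaban1983RegularityDecay, (1.13) p.573] -/
theorem cOpLam_posDef {H : Matrix X X ℝ} {ak : ℝ} {Qk : Matrix Y X ℝ} {a ℓ w : ℝ} {Q : Matrix Z Y ℝ}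
    (hH0 : ∀ φ : X → ℝ, 0 ≤ φ ⬝ᵥ (H *ᵥ φ)) (hK : (kForm H ak Qk).PosDef) (hak : 0 < ak)
    (haℓ : 0 < a * ℓ) (hw : 0 < w)
    (hzero : ∀ φ : X → ℝ, φ ⬝ᵥ (H *ᵥ φ) = 0 → qNext Q Qk *ᵥ φ = 0 → φ = 0) (Λ : Finset Y) :
    (cOpLam H ak Qk a ℓ w Q Λ).PosDef :=
  posDef_submatrix_of_injective (form113_posDef hH0 hK hak haℓ hw hzero) Subtype.val_injective

omit [DecidableEq Z] in
/-- **(1.13) IS WELL POSED: `C^{(k)}_Λ(Ω,A)·(Δ^{(k)}(Ω,A) + aL^{−2}P(A))|_Λ = 1`** for every `Λ`, under the hypotheses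
of `form113_posDef`. [cite: Balaban1983RegularityDecay, (1.13) p.573] -/
theorem cLam_mul_cOpLam {H : Matrix X X ℝ} {ak : ℝ} {Qk : Matrix Y X ℝ} {a ℓ w : ℝ} {Q : Matrix Z Y ℝ}
    (hH0 : ∀ φ : X → ℝ, 0 ≤ φ ⬝ᵥ (H *ᵥ φ)) (hK : (kForm H ak Qk).PosDef) (hak : 0 < ak)
    (haℓ : 0 < a * ℓ) (hw : 0 < w)
    (hzero : ∀ φ : X → ℝ, φ ⬝ᵥ (H *ᵥ φ) = 0 → qNext Q Qk *ᵥ φ = 0 → φ = 0) (Λ : Finset Y) :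
    cLam H ak Qk a ℓ w Q Λ * cOpLam H ak Qk a ℓ w Q Λ = 1 := by
  rw [cLam]
  exact Matrix.nonsing_inv_mul _
    ((Matrix.isUnit_iff_isUnit_det _).1 (cOpLam_posDef hH0 hK hak haℓ hw hzero Λ).isUnit)

omit [DecidableEq Z] in
/-- `(Δ^{(k)}(Ω,A) + aL^{−2}P(A))|_Λ · C^{(k)}_Λ(Ω,A) = 1` for every `Λ`, under the hypotheses of `form113_posDef`.
[cite: Balaban1983RegularityDecay, (1.13) p.573] -/
theorem cOpLam_mul_cLam {H : Matrix X X ℝ} {ak : ℝ} {Qk : Matrix Y X ℝ} {a ℓ w : ℝ} {Q : Matrix Z Y ℝ}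
    (hH0 : ∀ φ : X → ℝ, 0 ≤ φ ⬝ᵥ (H *ᵥ φ)) (hK : (kForm H ak Qk).PosDef) (hak : 0 < ak)
    (haℓ : 0 < a * ℓ) (hw : 0 < w)
    (hzero : ∀ φ : X → ℝ, φ ⬝ᵥ (H *ᵥ φ) = 0 → qNext Q Qk *ᵥ φ = 0 → φ = 0) (Λ : Finset Y) :
    cOpLam H ak Qk a ℓ w Q Λ * cLam H ak Qk a ℓ w Q Λ = 1 := by
  rw [cLam]
  exact Matrix.mul_nonsing_inv _
    ((Matrix.isUnit_iff_isUnit_det _).1 (cOpLam_posDef hH0 hK hak haℓ hw hzero Λ).isUnit)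

omit [DecidableEq Z] in
/-- `C^{(k)}_Λ(Ω,A) > 0` (the covariance of the Gaussian (3.1)) for every `Λ`, under the hypotheses of
`form113_posDef` — here WITHOUT (3.6) (cf. `B4Ineq115Sect3Route.cLam_posDef`). [cite: Balaban1983RegularityDecay, (1.13) p.573, (3.1) p.586] -/
theorem cLam_posDef' {H : Matrix X X ℝ} {ak : ℝ} {Qk : Matrix Y X ℝ} {a ℓ w : ℝ} {Q : Matrix Z Y ℝ}
    (hH0 : ∀ φ : X → ℝ, 0 ≤ φ ⬝ᵥ (H *ᵥ φ)) (hK : (kForm H ak Qk).PosDef) (hak : 0 < ak)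
    (haℓ : 0 < a * ℓ) (hw : 0 < w)
    (hzero : ∀ φ : X → ℝ, φ ⬝ᵥ (H *ᵥ φ) = 0 → qNext Q Qk *ᵥ φ = 0 → φ = 0) (Λ : Finset Y) :
    (cLam H ak Qk a ℓ w Q Λ).PosDef := by
  rw [cLam]
  exact (cOpLam_posDef hH0 hK hak haℓ hw hzero Λ).inv

/-- the form of a diagonal indicator: `⟨v, D_S v⟩ = Σ_{y∈S} v(y)²` (private plumbing). [folklore] -/
private theorem diagInd_form (S : Finset Y) (v : Y → ℝ) :
    v ⬝ᵥ (diagInd S *ᵥ v) = ∑ y, (if y ∈ S then v y * v y else 0) := by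
  simp only [dotProduct, diagInd, Matrix.mulVec_diagonal]
  refine Finset.sum_congr rfl fun y _ => ?_
  split_ifs <;> ring

omit [DecidableEq X] in
/-- the form `⟨v, XᵀD_SXv⟩ = Σ_{y∈S} (Xv)(y)²` of the averaging terms of (3.5) (private plumbing). [folklore] -/
private theorem sandwich_form {W : Type*} [Fintype W] [DecidableEq W] (M : Matrix W X ℝ) (S : Finset W)
    (φ : X → ℝ) :
    φ ⬝ᵥ ((Mᵀ * diagInd S * M) *ᵥ φ) = ∑ y, (if y ∈ S then (M *ᵥ φ) y * (M *ᵥ φ) y else 0) := by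
  rw [Matrix.mul_assoc, ← Matrix.mulVec_mulVec, Matrix.dotProduct_mulVec φ Mᵀ, Matrix.vecMul_transpose,
    ← Matrix.mulVec_mulVec, diagInd_form]

omit [DecidableEq X] in
/-- such a form is non-negative (private plumbing). [folklore] -/
private theorem sandwich_form_nonneg {W : Type*} [Fintype W] [DecidableEq W] (M : Matrix W X ℝ) (S : Finset W)
    (φ : X → ℝ) : 0 ≤ φ ⬝ᵥ ((Mᵀ * diagInd S * M) *ᵥ φ) := by
  rw [sandwich_form]
  exact Finset.sum_nonneg fun y _ => by split_ifs <;> nlinarith [mul_self_nonneg ((M *ᵥ φ) y)]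

omit [DecidableEq X] in
/-- and vanishes only if `(Mφ)(y) = 0` on `S` (private plumbing). [folklore] -/
private theorem sandwich_form_eq_zero {W : Type*} [Fintype W] [DecidableEq W] (M : Matrix W X ℝ) (S : Finset W)
    {φ : X → ℝ} (h : φ ⬝ᵥ ((Mᵀ * diagInd S * M) *ᵥ φ) = 0) : ∀ y ∈ S, (M *ᵥ φ) y = 0 := by
  rw [sandwich_form] at h
  intro y hy
  have hterm := (Finset.sum_eq_zero_iff_of_nonneg fun y' _ => show
    (0 : ℝ) ≤ (if y' ∈ S then (M *ᵥ φ) y' * (M *ᵥ φ) y' else 0) by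
      split_ifs <;> nlinarith [mul_self_nonneg ((M *ᵥ φ) y')]).1 h y (Finset.mem_univ y)
  rw [if_pos hy] at hterm
  exact mul_self_eq_zero.1 hterm

omit [DecidableEq X] in
/-- **THE TWO-SCALE FORM (3.5) `K̂_Λ = H + a_kQ_kᵀD_{Λᶜ}Q_k + a_{k+1}L^{d}L^{−2}Q_{k+1}ᵀD_{Λ′}Q_{k+1}` IS POSITIVE
DEFINITE** for every block-compatible pair `(Λ, Λ′)` («Λ a sum of big blocks»), under: `H` symmetric with
`⟨φ,Hφ⟩ ≥ 0`, `a_k > 0`, `a_{k+1}wℓ > 0`, and the zero-mode hypothesis «`⟨φ,Hφ⟩ = 0` and `Q_{k+1}φ = QQ_kφ = 0` imply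
`φ = 0`».  Mechanism: at a zero mode all three squares vanish, so `(Q_kφ)(y) = 0` off `Λ` and `(Q_{k+1}φ)(z) = 0`
on `Λ′`; block compatibility transfers the first to `(Q_{k+1}φ)(z) = 0` off `Λ′`. — This is the hypothesis `hKΛ` of
`B4GaussRep36.Rep36`, `B4Ineq115Sect3Route`, `B4Prop23BlockAvg`, `B4Prop23Sect5Route`.
[cite: Balaban1983RegularityDecay, (3.5) p.587] -/
theorem kLam_posDef {H : Matrix X X ℝ} {ak : ℝ} {Qk : Matrix Y X ℝ} {a ℓ w : ℝ} {Q : Matrix Z Y ℝ}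
    {Λ : Finset Y} {Λ' : Finset Z} (hHs : H.IsSymm) (hH0 : ∀ φ : X → ℝ, 0 ≤ φ ⬝ᵥ (H *ᵥ φ)) (hak : 0 < ak)
    (hc : 0 < aNext a ak ℓ * w * ℓ) (hB : BlockCompatible Q Λ Λ')
    (hzero : ∀ φ : X → ℝ, φ ⬝ᵥ (H *ᵥ φ) = 0 → qNext Q Qk *ᵥ φ = 0 → φ = 0) :
    (kLam H ak Qk a ℓ w Q Λ Λ').PosDef := by
  refine Matrix.PosDef.of_dotProduct_mulVec_pos ?_ fun φ hφ => ?_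
  · rw [Matrix.IsHermitian, Matrix.conjTranspose_eq_transpose_of_trivial, kLam, Matrix.transpose_add,
      Matrix.transpose_add, hHs.eq, Matrix.transpose_smul, Matrix.transpose_smul, Matrix.transpose_mul,
      Matrix.transpose_mul, Matrix.transpose_transpose, Matrix.transpose_mul, Matrix.transpose_mul,
      Matrix.transpose_transpose, diagInd, diagInd, Matrix.diagonal_transpose, Matrix.diagonal_transpose,
      ← Matrix.mul_assoc, ← Matrix.mul_assoc]
  rw [star_trivial]
  have e : φ ⬝ᵥ (kLam H ak Qk a ℓ w Q Λ Λ' *ᵥ φ) = φ ⬝ᵥ (H *ᵥ φ)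
      + ak * (φ ⬝ᵥ ((Qkᵀ * diagInd Λᶜ * Qk) *ᵥ φ))
      + aNext a ak ℓ * w * ℓ * (φ ⬝ᵥ (((qNext Q Qk)ᵀ * diagInd Λ' * qNext Q Qk) *ᵥ φ)) := by
    rw [kLam, Matrix.add_mulVec, Matrix.add_mulVec, dotProduct_add, dotProduct_add, Matrix.smul_mulVec,
      Matrix.smul_mulVec, dotProduct_smul, dotProduct_smul, smul_eq_mul, smul_eq_mul]
  have h1 := hH0 φ
  have h2 := sandwich_form_nonneg Qk Λᶜ φ
  have h3 := sandwich_form_nonneg (qNext Q Qk) Λ' φ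
  rw [e]
  rcases (add_nonneg (add_nonneg h1 (mul_nonneg hak.le h2)) (mul_nonneg hc.le h3)).lt_or_eq with h | h
  · exact h
  · exfalso
    have hH : φ ⬝ᵥ (H *ᵥ φ) = 0 := by nlinarith [mul_nonneg hak.le h2, mul_nonneg hc.le h3]
    have hk : φ ⬝ᵥ ((Qkᵀ * diagInd Λᶜ * Qk) *ᵥ φ) = 0 := by
      have : ak * (φ ⬝ᵥ ((Qkᵀ * diagInd Λᶜ * Qk) *ᵥ φ)) = 0 := by nlinarith [mul_nonneg hc.le h3]
      rcases mul_eq_zero.1 this with h' | h'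
      · exact absurd h' hak.ne'
      · exact h'
    have hn : φ ⬝ᵥ (((qNext Q Qk)ᵀ * diagInd Λ' * qNext Q Qk) *ᵥ φ) = 0 := by
      have : aNext a ak ℓ * w * ℓ * (φ ⬝ᵥ (((qNext Q Qk)ᵀ * diagInd Λ' * qNext Q Qk) *ᵥ φ)) = 0 := by nlinarith
      rcases mul_eq_zero.1 this with h' | h'
      · exact absurd h' hc.ne'
      · exact h'
    have hoff := sandwich_form_eq_zero Qk Λᶜ hk
    have hon := sandwich_form_eq_zero (qNext Q Qk) Λ' hn
    -- `Q_{k+1}φ = 0` everywhere: on `Λ′` by `hon`, off `Λ′` by block compatibility and `hoff`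
    have hall : qNext Q Qk *ᵥ φ = 0 := by
      funext z
      by_cases hz : z ∈ Λ'
      · exact hon z hz
      · rw [qNext, ← Matrix.mulVec_mulVec]
        simp only [Matrix.mulVec, dotProduct, Pi.zero_apply]
        refine Finset.sum_eq_zero fun y _ => ?_
        by_cases hQ : Q z y = 0
        · rw [hQ, zero_mul]
        · have hy : y ∉ Λ := fun hy => hz ((hB z y hQ).1 hy)
          have := hoff y (Finset.mem_compl.2 hy)
          simp only [Matrix.mulVec, dotProduct] at this
          rw [this, mul_zero]
    exact hφ (hzero φ hH hall)

omit [DecidableEq Y] [DecidableEq Z] in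
/-- the whole lattice is block compatible with the whole next lattice (private plumbing). [folklore] -/
private theorem blockCompatible_univ (Q : Matrix Z Y ℝ) : BlockCompatible Q Finset.univ Finset.univ :=
  fun z y _ => by simp only [Finset.mem_univ]

omit [DecidableEq X] in
/-- **THE FORM OF `G^η_{k+1}(Ω, A) = (−Δ^{η,N}_{A,Ω} + m_k² + a_{k+1}L^{−2}P_{k+1}(A))^{−1}` (3.9) — the case
`Λ = Ω^{(k)}` of (3.5) — IS POSITIVE DEFINITE** under the hypotheses of `kLam_posDef` (no block compatibility
needed).  This is the hypothesis `hKU` of `B4Ineq115Sect3Route.form115_lower`, `B4Prop23BlockAvg`,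
`B4Prop23Sect5Route`. [cite: Balaban1983RegularityDecay, (3.5) p.587, (3.9) p.588] -/
theorem kLam_univ_posDef {H : Matrix X X ℝ} {ak : ℝ} {Qk : Matrix Y X ℝ} {a ℓ w : ℝ} {Q : Matrix Z Y ℝ}
    (hHs : H.IsSymm) (hH0 : ∀ φ : X → ℝ, 0 ≤ φ ⬝ᵥ (H *ᵥ φ)) (hak : 0 < ak) (hc : 0 < aNext a ak ℓ * w * ℓ)
    (hzero : ∀ φ : X → ℝ, φ ⬝ᵥ (H *ᵥ φ) = 0 → qNext Q Qk *ᵥ φ = 0 → φ = 0) :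
    (kLam H ak Qk a ℓ w Q Finset.univ Finset.univ).PosDef :=
  kLam_posDef hHs hH0 hak hc (blockCompatible_univ Q) hzero

omit [Fintype Z] [DecidableEq X] [DecidableEq Y] [DecidableEq Z] in
/-- The zero-mode hypothesis is VACUOUS for a positive definite `H` (`m² > 0`). [cite: Balaban1983RegularityDecay, (1.6) p.572 «m² ≥ 0»] -/
theorem hzero_of_posDef {H : Matrix X X ℝ} (hH : H.PosDef) (Qk : Matrix Y X ℝ) (Q : Matrix Z Y ℝ) :
    ∀ φ : X → ℝ, φ ⬝ᵥ (H *ᵥ φ) = 0 → qNext Q Qk *ᵥ φ = 0 → φ = 0 := by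
  intro φ h0 _
  by_contra hφ
  have h := hH.dotProduct_mulVec_pos hφ
  rw [star_trivial, h0] at h
  exact lt_irrefl _ h

end Abstract

end Literature.MathematicalPhysics.QuantumFieldTheory.Balaban1983to89.B4Eq35TwoScalePosDef
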